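import Mathlib

/-!
# A would-be geometric shortcut to the "first-order count" at the `fg + 1` corner is FALSE

Context (crux `TwoProducts`, stmt-ValiantsHypothesis-5906; line `corner-log-linearization`, stub `stub_logSumNewton`;
Disproof.lean §3 F9 `FirstOrderCount`).  At a cancelling corner with two factors `u₁ = 1 + h₁`, `u₂ = 1 + h₂`
(`A = supp h₁`, `B = supp h₂`) every south-west vertex `k` of `Newt(h₁ + h₂ + h₁h₂)` that is not a first-order point is a
sum `a + b` of two CANCELLED first-order points, both lying outside `Γ_K = conv K + ℝ²₊` (drefute gen-2 notes §E-G).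
It is therefore tempting to prove the first-order count `V ≤ |A| + |B|` from the purely geometric statement

  `SumChainBound`:  for a strictly convex, strictly decreasing lattice chain `K` and finite sets `A, B` of lattice points
  outside `Γ_K`, the sumset `A + B` meets `K` in at most `|A| + |B|` points.

This file refutes `SumChainBound` (stated inline in `not_sumChainBound`, no new `Prop` constant) with an explicit instance (a 20-vertex chain, `|A| = 4`, `|B| = 5`, ten distinct sums on
the chain), found by annealing (kit job j013954, `cdesign2.py` GEOM mode) and checked here by `decide`.  Consequence for
provers: any proof of the first-order count must use the ALGEBRA of the cancellation cascade (one-sided cancelled points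
are sums of lower cancelled points; cancelling a non-common point costs a coefficient equation), not convexity alone.
Equality `|A|+|B|` is already reached by the Prouhet–Tarry–Escott 6-cycle `{0,4,5} ~ {1,2,6}` on a parabola chain.
-/

set_option linter.dupNamespace false

namespace Summit.ValiantsHypothesis.ValiantsHypothesis.Theorems.TwoProducts.Negative

/-- `K`, listed by increasing `x`, is a strictly decreasing, strictly convex ("south-west") lattice chain: consecutive
points go right and down, and slopes strictly increase (left turns), written division- and subtraction-safely over `ℕ`:
for consecutive `p q r`, `(q₂ − r₂)(q₁ − p₁) < (p₂ − q₂)(r₁ − q₁)`. [folklore] -/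
def isSWChain : List (ℕ × ℕ) → Bool
  | [] => true
  | [_] => true
  | p :: q :: rest =>
      decide (p.1 < q.1) && decide (q.2 < p.2) &&
        (match rest with
          | [] => true
          | r :: _ => decide ((q.2 - r.2) * (q.1 - p.1) < (p.2 - q.2) * (r.1 - q.1))) &&
        isSWChain (q :: rest)

/-- `e` lies strictly below the segment from `u` to `v` (for `u₁ ≤ e₁`, `v₂ ≤ u₂`), subtraction-safely:
`(v₁−u₁)·e₂ + (u₂−v₂)·(e₁−u₁) < (v₁−u₁)·u₂`  (this is `cross (u,v,e) < 0`). [folklore] -/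
def belowSeg (u v e : ℕ × ℕ) : Bool :=
  decide ((v.1 - u.1) * e.2 + (u.2 - v.2) * (e.1 - u.1) < (v.1 - u.1) * u.2)

/-- Walk the chain: is `e` outside `Γ_K = conv K + ℝ²₊`?  Left of the first vertex; or in the `x`-range of an edge and
strictly below it (or on the vertical line of its left end, below it); or weakly right of the last vertex and strictly
below it. [folklore] -/
def outsideAux (e : ℕ × ℕ) : List (ℕ × ℕ) → Bool
  | [] => false
  | [w] => decide (w.1 ≤ e.1) && decide (e.2 < w.2)
  | u :: v :: rest =>
      (decide (u.1 ≤ e.1) && decide (e.1 < v.1) &&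
          (belowSeg u v e || (decide (e.1 = u.1) && decide (e.2 < u.2)))) ||
        outsideAux e (v :: rest)

/-- `e ∉ Γ_K` for the south-west chain `K` (listed by increasing `x`). [folklore] -/
def outside (K : List (ℕ × ℕ)) (e : ℕ × ℕ) : Bool :=
  match K with
  | [] => true
  | k :: _ => decide (e.1 < k.1) || outsideAux e K

/-- Number of chain vertices hit by the sumset `A + B`. [folklore] -/
def hits (K A B : List (ℕ × ℕ)) : ℕ :=
  (K.filter fun k => (A.any fun a => B.any fun b => decide (a.1 + b.1 = k.1 ∧ a.2 + b.2 = k.2))).length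

/-- The 20-vertex witness chain. -/
def K₀ : List (ℕ × ℕ) :=
  [(1,55),(2,50),(3,46),(4,43),(6,38),(7,36),(10,31),(12,28),(15,24),(19,19),(20,18),(25,14),(29,11),(32,9),(37,6),
   (39,5),(44,3),(47,2),(51,1),(56,0)]

/-- Witness `A` (4 points below the chain). -/
def A₀ : List (ℕ × ℕ) := [(2,6),(3,2),(4,1),(5,1)]

/-- Witness `B` (5 points below the chain). -/
def B₀ : List (ℕ × ℕ) := [(0,44),(2,37),(5,30),(16,17),(34,4)]

/-- The witness sums hit ten chain vertices: (2,50),(3,46),(4,43),(6,38),(7,36),(10,31),(19,19),(20,18),(37,6),(39,5). -/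
theorem hits_witness : hits K₀ A₀ B₀ = 10 := by decide

/-- **The would-be geometric shortcut `SumChainBound` is false.**  It says: for every south-west convex lattice
chain `K` (no repeated vertices) and duplicate-free lists `A`, `B` of lattice points outside `Γ_K`, the sumset `A + B`
meets `K` in at most `|A| + |B|` points.  The witness `K₀, A₀, B₀` gives `10 > 4 + 5`. [folklore] -/
theorem not_sumChainBound :
    ¬ ∀ (K A B : List (ℕ × ℕ)), isSWChain K = true → K.Nodup → A.Nodup → B.Nodup →
        (∀ a ∈ A, outside K a = true) → (∀ b ∈ B, outside K b = true) → hits K A B ≤ A.length + B.length := by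
  intro h
  have h1 := h K₀ A₀ B₀ (by decide) (by decide) (by decide) (by decide) (by decide) (by decide)
  rw [hits_witness] at h1
  exact absurd h1 (by decide)

end Summit.ValiantsHypothesis.ValiantsHypothesis.Theorems.TwoProducts.Negative
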